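import Literature.NumberTheory.EllipticCurves.KatoFineSelmerDualProofs
import Literature.NumberTheory.EllipticCurves.Rank1Residual.FineMordellWeilCertificates
import Summits.BirchSwinnertonDyer.Rank1Residual.X11a.Cells
import HarnessLib

/-!
# Route `PrintX11a`, child crux U3 = `PrintX11a.UpperNonSurjThree` (item stmt-BirchSwinnertonDyer-20613),
# line «finemu3», stub `FineMu.stub_conjA_three` — the ♯0 road's Iwasawa-theoretic half, PROVED:
# «no non-zero `Γ`-fixed `p`-torsion class in `Sel₀(K_∞, E[p^∞])` ⟹ `Sel₀(K_∞, E[p^∞]) = 0`» (Nakayama for the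
# discrete `p`-primary `Γ`-module `Sel₀`), hence statement (A) at the pair
# (cell `bsd-print-x11a`, width seat `bsd-line-x11a-p1-w2`, brief of LEAD x11a-p1 2026-08-28T05:17:56Z;
# `--supports` 20613; closes nothing)

HONEST FRAMING.  BSD is not proved by any of this; nothing is asserted about any curve; the crux and its stub
`stub_conjA_three` stay OPEN.  THEOREMS ONLY (no definition, no named fact, no `sorry`), all PROVED from tree
theorems: Greenberg's two structural facts on `H¹(K_∞, E[p^∞])` — every class is killed by a power of `p`
(`WeierstrassCurve.exists_pow_smul_subgroupH1_ker_eq_zero`) and fixed by `conj_{γ^{p^a}}` for some `a`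
(`WeierstrassCurve.exists_conjH1_pow_prime_pow_eq`), packaged by the tree as the local nilpotence of
`T = conj_γ − 1` on `Sel₀` (`WeierstrassCurve.isLocNil_conjFineSelmerInfty_sub_one`).

WHAT.  Critic idea-crit-10's price (P2) on line «finemu3» (Lines/finemu3.md) replaces Deo–Ray–Sujatha's local
hypothesis (c3) — which FAILS on the U3 domain at a split-multiplicative `3` and at every multiplicative `ℓ ≠ 3` of
an X11a pair — by the ♯-criterion: with `Sel₀♯(ℚ_∞) ⊇ Sel₀(ℚ_∞, E[p^∞])[p]`,
«♯0: `R♯(E,p) := Sel₀♯(ℚ_∞)^Γ = 0 ⟹ Sel₀♯(ℚ_∞) = 0` (Nakayama, `Γ` pro-`p` on a discrete `p`-group)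
`⟹ X₀(E/ℚ_∞) = 0 ⟹ (A)`».  This file KERNEL-CHECKS the Iwasawa-theoretic half of ♯0 in its sharpest form and
with NO arithmetic hypothesis (any number field `K`, any `ℤ_p`-extension `κ`, any topological generator `γ`,
any Weierstrass curve): if the only `p`-torsion class of `Sel₀(K_∞, E[p^∞])` fixed by `conj_γ` is `0`, then
`Sel₀(K_∞, E[p^∞]) = 0` (§1, `fineSelmerInfty_eq_bot_of_forall_pTorsion_fixed_eq_zero`).  Proof: `T = conj_γ − 1`
is locally nilpotent on `Sel₀` and commutes with `p`; if `t ≠ 0` is `p`-torsion with `Tᴺ t = 0`, `N` minimal,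
then `T^{N−1} t` is a non-zero `Γ`-fixed `p`-torsion class; so `Sel₀[p] = 0`, and a `p`-primary group with no
`p`-torsion is `0`.  §2 reads it in the carriers' vocabulary over `ℚ`: the hypothesis at every cyclotomic `κ`
gives `Rank1Residual.FineSelmerTrivialAt W p`, hence statement (A) `Rank1Residual.ConjAAt W p`
(`FineSelmerTrivialAt.conjAAt`) and pointwise `μ(X₀) = 0`; §3 restates the door on the route's domain
`ClassX11a W p ∧ ¬ Surj W p`.  What is NOT here (the other half of ♯0, theorem-grade on paper, to be typed as the
line's certificate node): the identification of the `Γ`-fixed `p`-torsion of `Sel₀(ℚ_∞, E[p^∞])` with the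
LEVEL-0 residual group `R♯(E,p) ⊆ H¹(ℚ_S/ℚ, E[p])` (inflation–restriction + `E(ℚ_∞)[p] = 0` on tame irreducible
pairs + the local subgroups `A_w`), which is what a kit engine computes per pair.

References: [GreenbergLNM1716] §1 (PDF p. 60: `H¹(F_∞, E[p^∞])` is a torsion `ℤ_p`-module on which every
element is killed by `Tⁿ`); [CoatesSujatha2005] §3 statement (A); [Washington1997] §13.2 (Nakayama's lemma for
compact/discrete `Λ`-modules); [DeoRaySujatha2023] §3 (c1)–(c3), Thm. 3.9; line card Lines/finemu3.md (P2).
-/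

set_option linter.dupNamespace false
set_option autoImplicit false

noncomputable section

open scoped Classical

open WeierstrassCurve Field
  Literature.NumberTheory.EllipticCurves
  Literature.NumberTheory.EllipticCurves.Rank1Residual
  Summit.BirchSwinnertonDyer.Rank1Residual

namespace Summit.BirchSwinnertonDyer.BirchSwinnertonDyer.Theorems.UpperNonSurjThreeSharp

universe u

/-! ### §1 Nakayama for `Sel₀(K_∞, E[p^∞])`: no `Γ`-fixed `p`-torsion ⟹ no `p`-torsion ⟹ zero -/

section Nakayama

variable {K : Type u} [Field K] [NumberField K] (W : WeierstrassCurve K) {p : ℕ} [Fact p.Prime]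
  (κ : ZpExtension K p) {γ : absoluteGaloisGroup K}

/-- **`Sel₀(K_∞, E[p^∞])[p] = 0` if its only `conj_γ`-fixed element is `0`** (`γ` a topological generator of
`Gal(K_∞/K)`): `T = conj_γ − 1` is locally nilpotent on `Sel₀` (tree: `isLocNil_conjFineSelmerInfty_sub_one`) and
additive, so for a `p`-torsion `t` with `Tᴺ t = 0` an induction on `N` applies the hypothesis to `T^{N−1} t`.
[cite: GreenbergLNM1716, §1 (PDF p. 60)] [cite: Washington1997, §13.2 (Nakayama's lemma)] -/
theorem fineSelmerInfty_pTorsion_eq_zero_of_forall_fixed_eq_zero (hγ : κ.IsTopGenerator γ)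
    (h : ∀ s : W.fineSelmerInfty κ, p • s = 0 → W.conjFineSelmerInfty κ γ s = s → s = 0)
    (t : W.fineSelmerInfty κ) (ht : p • t = 0) : t = 0 := by
  obtain ⟨N, hN⟩ := (W.isLocNil_conjFineSelmerInfty_sub_one κ hγ).nil t
  induction N generalizing t with
  | zero => simpa using hN
  | succ N ih =>
    -- `T^{N+1} t = T^N (T t)` and `T t` is again `p`-torsion
    have hTt : p • ((W.conjFineSelmerInfty κ γ - 1) t) = 0 := by
      rw [← map_nsmul, ht, map_zero]
    have hTN : ((W.conjFineSelmerInfty κ γ - 1) ^ N) ((W.conjFineSelmerInfty κ γ - 1) t) = 0 := by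
      rw [← Function.comp_apply (f := ⇑((W.conjFineSelmerInfty κ γ - 1) ^ N)), ← AddMonoid.End.coe_mul,
        ← pow_succ, hN]
    have h0 : (W.conjFineSelmerInfty κ γ - 1) t = 0 := ih _ hTt hTN
    refine h t ht ?_
    rw [IwasawaDual.End_sub_apply, AddMonoid.End.one_apply, sub_eq_zero] at h0
    exact h0

/-- **NAKAYAMA FOR THE FINE SELMER GROUP**: for any number field `K`, any `ℤ_p`-extension `K_∞/K` with
topological generator `γ`, and any Weierstrass curve `W/K`, if the only `p`-TORSION class of `Sel₀(K_∞, E[p^∞])`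
FIXED by `conj_γ` is `0`, then `Sel₀(K_∞, E[p^∞]) = 0` — every class is killed by a power of `p`
(tree: `exists_pow_smul_subgroupH1_ker_eq_zero`), so «no `p`-torsion» forces «zero» by induction on the exponent.
The Iwasawa-theoretic half of the ♯0 criterion of line «finemu3» (P2); NO arithmetic hypothesis.
[cite: GreenbergLNM1716, §1 (PDF p. 60)] [cite: Washington1997, §13.2 (Nakayama's lemma)] -/
theorem fineSelmerInfty_eq_bot_of_forall_pTorsion_fixed_eq_zero (hγ : κ.IsTopGenerator γ)
    (h : ∀ s ∈ W.fineSelmerInfty κ, p • s = 0 → W.conjH1 p κ.kerSubgroup γ s = s → s = 0) :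
    W.fineSelmerInfty κ = ⊥ := by
  -- the hypothesis on the subtype
  have h' : ∀ s : W.fineSelmerInfty κ, p • s = 0 → W.conjFineSelmerInfty κ γ s = s → s = 0 := by
    intro s hs hfix
    have hs' : p • (s : W.subgroupH1 p κ.kerSubgroup) = 0 := by
      rw [← AddSubgroupClass.coe_nsmul, hs]; rfl
    have hfix' : W.conjH1 p κ.kerSubgroup γ s = s := by
      rw [← coe_conjFineSelmerInfty_apply, hfix]
    exact Subtype.ext (h s s.2 hs' hfix')
  -- no `p`-torsion ⟹ zero, by induction on the `p`-power exponent killing a class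
  have hall : ∀ (k : ℕ) (s : W.fineSelmerInfty κ), p ^ k • s = 0 → s = 0 := by
    intro k
    induction k with
    | zero => intro s hs; simpa using hs
    | succ k ih =>
      intro s hs
      have hps : p ^ k • (p • s) = 0 := by rw [← mul_nsmul', ← pow_succ, hs]
      have hp0 : p • s = 0 := ih _ hps
      exact fineSelmerInfty_pTorsion_eq_zero_of_forall_fixed_eq_zero W κ hγ h' s hp0
  rw [eq_bot_iff]
  intro s hs
  obtain ⟨k, hk⟩ := (W.isLocNil_conjFineSelmerInfty_sub_one κ hγ).torsion ⟨s, hs⟩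
  have := hall k ⟨s, hs⟩ hk
  rw [AddSubgroup.mem_bot]
  exact congrArg Subtype.val this

end Nakayama

/-! ### §2 Over `ℚ`: the hypothesis at every cyclotomic `κ` gives `Sel₀ = 0`, statement (A) and `μ(X₀) = 0` -/

section OverQ

variable (W : WeierstrassCurve ℚ) [W.IsElliptic] (p : ℕ) [Fact p.Prime]

/-- **`Sel₀(ℚ_∞, E[p^∞]) = 0` at the pair** (`Rank1Residual.FineSelmerTrivialAt`) from the ♯0 hypothesis «for every
cyclotomic `ℤ_p`-extension datum `κ` and topological generator `γ`, the only `conj_γ`-fixed `p`-torsion class of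
`Sel₀(ℚ_∞, E[p^∞])` is `0`» (by paper inflation–restriction on tame irreducible pairs this fixed part is the level-0
residual group `R♯(E,p)`; that identification is NOT proved here).  PROVED, no named fact.
[cite: GreenbergLNM1716, §1 (PDF p. 60)] [cite: CoatesSujatha2005, §3 statement (A)] -/
theorem fineSelmerTrivialAt_of_forall_pTorsion_fixed_eq_zero
    (h : ∀ (κ : ZpExtension ℚ p) (γ : absoluteGaloisGroup ℚ), κ.IsCyclotomic → κ.IsTopGenerator γ →
      ∀ s ∈ W.fineSelmerInfty κ, p • s = 0 → W.conjH1 p κ.kerSubgroup γ s = s → s = 0) :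
    FineSelmerTrivialAt W p := by
  intro κ hκ
  obtain ⟨γ, hγ⟩ : ∃ γ : absoluteGaloisGroup ℚ, κ.IsTopGenerator γ := κ.surjective (Multiplicative.ofAdd 1)
  exact fineSelmerInfty_eq_bot_of_forall_pTorsion_fixed_eq_zero W κ hγ (h κ γ hκ hγ)

/-- **Statement (A) at the pair** (`Rank1Residual.ConjAAt W p`, the conclusion of `FineMu.stub_conjA_three` at the
pair) from the ♯0 hypothesis, via `FineSelmerTrivialAt.conjAAt` (the zero module is a fine dual datum, finite over
`ℤ_p`).  PROVED, no named fact; (A) is asserted for no curve (the hypothesis is the per-pair input).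
[cite: CoatesSujatha2005, §3 statement (A)] [cite: GreenbergLNM1716, §1 (PDF p. 60)] -/
theorem conjAAt_of_forall_pTorsion_fixed_eq_zero
    (h : ∀ (κ : ZpExtension ℚ p) (γ : absoluteGaloisGroup ℚ), κ.IsCyclotomic → κ.IsTopGenerator γ →
      ∀ s ∈ W.fineSelmerInfty κ, p • s = 0 → W.conjH1 p κ.kerSubgroup γ s = s → s = 0) :
    ConjAAt W p :=
  (fineSelmerTrivialAt_of_forall_pTorsion_fixed_eq_zero W p h).conjAAt

/-- **Pointwise `μ(X₀(E/ℚ_∞)) = 0` at the pair** (`Rank1Residual.FineMuZeroAt W p`) from the ♯0 hypothesis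
(through (A) and the tree theorem T0 `ConjAAt.fineMuZeroAt`).  PROVED, no named fact.
[cite: CoatesSujatha2005, §3 statement (A), `μ`-form] [cite: GreenbergLNM1716, §1 (PDF p. 60)] -/
theorem fineMuZeroAt_of_forall_pTorsion_fixed_eq_zero
    (h : ∀ (κ : ZpExtension ℚ p) (γ : absoluteGaloisGroup ℚ), κ.IsCyclotomic → κ.IsTopGenerator γ →
      ∀ s ∈ W.fineSelmerInfty κ, p • s = 0 → W.conjH1 p κ.kerSubgroup γ s = s → s = 0) :
    FineMuZeroAt W p :=
  (fineSelmerTrivialAt_of_forall_pTorsion_fixed_eq_zero W p h).fineMuZeroAt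

end OverQ

/-! ### §3 On the route's domain `ClassX11a W p ∧ ¬ Surj W p` (U3 at `p = 3`): the door a ♯0 record applies -/

/-- **♯0 door on the finemu3 domain**: at a non-surjective X11a pair, the ♯0 hypothesis gives statement (A) at the
pair — the conclusion of `FineMu.stub_conjA_three` for THIS `W` (the class and image hypotheses are not used by
the proof; they fix the domain on which the line consumes the door and on which the level-0 certificate `R♯(E,p)`
computes the hypothesis).  PROVED, no named fact; nothing asserted about any curve.
[cite: CoatesSujatha2005, §3 statement (A)] [cite: DeoRaySujatha2023, Thm. 3.9 (the (c3)-road this replaces on U3)] -/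
theorem _root_.Summit.BirchSwinnertonDyer.Rank1Residual.ClassX11a.conjAAt_of_forall_pTorsion_fixed_eq_zero
    (W : WeierstrassCurve ℚ) [W.IsElliptic] [W.IsGloballyMinimal] (p : ℕ) [Fact p.Prime]
    (_hX : ClassX11a W p) (_hns : ¬ Surj W p)
    (h : ∀ (κ : ZpExtension ℚ p) (γ : absoluteGaloisGroup ℚ), κ.IsCyclotomic → κ.IsTopGenerator γ →
      ∀ s ∈ W.fineSelmerInfty κ, p • s = 0 → W.conjH1 p κ.kerSubgroup γ s = s → s = 0) :
    ConjAAt W p :=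
  UpperNonSurjThreeSharp.conjAAt_of_forall_pTorsion_fixed_eq_zero W p h

end Summit.BirchSwinnertonDyer.BirchSwinnertonDyer.Theorems.UpperNonSurjThreeSharp

end
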